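import Literature.NumberTheory.DiophantineGeometry.AbelianSchemeModelReduction
import Literature.NumberTheory.GaloisRepresentations.IntegralGaloisActionProofs
import Literature.NumberTheory.GaloisRepresentations.RamificationFiltrationProofs
import Literature.AlgebraicGeometry.Motives.TateModuleOfTorsionEquivs
import HarnessLib

/-!
# Inertia acts trivially on the prime-to-`v` torsion of an abelian variety with an abelian-scheme model

Let `A` be an abelian variety over a number field `K`, `v` a finite place and `𝒜 → Spec 𝓞_{K,v}` an
abelian-scheme model of `A` at `v` (`h : IsAbelianSchemeModel A v 𝒜`), with reduction map
`red_v = h.specialFibreReductionHom : A(K̄) → 𝒜_v(κ̄(v))` (`AbelianSchemeModelReduction`: `Γ_{K_v}`-equivariant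
along `res : Γ_{K_v} → Γ_K`, inertia of `K_v` acting trivially on the target) and the prime
`𝔓ᵥ = adicCompletionPrime K v` of `ℤ̄_K` above `v` cut out by `K̄ → K̄_v` (`DecompositionGroupOfCompletion`:
`I(𝔓ᵥ) = res (I_{K_v})`).  Serre–Tate 1968, §1, proof of Thm. 1 («`I(v̄)` acts trivially on `A_m` for `m` prime to
the residue characteristic, since the reduction map is an injective `D(v̄)`-morphism `A_m → Ã_m` and `I(v̄)` acts
trivially on `Ã`»):

* `IsAbelianSchemeModel.smul_eq_self_of_mem_inertia_of_mem_geomTorsion` — **if `red_v` is injective on `A[m](K̄)`,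
  the inertia group `I(𝔓ᵥ) ≤ Γ_K` fixes `A[m](K̄)` pointwise** (the injectivity on `ℓⁿ`-torsion, `v ∤ ℓ`, is
  Serre–Tate Lemma 2 — supplied separately; here it is the hypothesis `hinj`);
* `IsAbelianSchemeModel.forall_smul_eq_self_of_mem_inertia_of_injOn` — the same for all `ℓⁿ` at once, in the binder
  shape `hinert` of `GoodReductionAt.exists_tateSpecialisation_of_reductionMap`
  (`AbelianVarietyTateSpecialisationOfReduction`), at `𝔓 := adicCompletionPrime K v`;
* `smul_eq_self_of_mem_inertia_smul_of_forall` / `IsAbelianSchemeModel.smul_eq_self_of_mem_inertia_of_mem_primesAbove`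
  — transport to EVERY prime `𝔓 ∣ v` of `ℤ̄_K` (the primes above `v` are `Γ_K`-conjugate,
  `exists_smul_eq_of_mem_primesAbove_holds`, and `I(τ • 𝔓) = τ I(𝔓) τ⁻¹`, `Ideal.inertia_smul`; a `Γ_K`-stable
  subgroup fixed pointwise by `I(𝔓)` is fixed pointwise by `I(τ • 𝔓)`);
* `IsAbelianSchemeModel.forall_inertia_tateRep_eq_one_of_injOn` /
  `IsAbelianSchemeModel.exists_primesAbove_forall_inertia_tateRep_eq_one_of_injOn` — **the `T_ℓ` form
  `ρ_{A,ℓ}(σ) = 1` for `σ ∈ I(𝔓)`, `𝔓 ∣ v`** (Serre–Tate Thm. 1 (b) ⇒ (c), through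
  `tateRep_eq_one_of_forall_geomTorsion`, `TateModuleOfTorsionEquivs`), granted injectivity of `red_v` on every
  `A[ℓⁿ](K̄)` — the shape of the Néron–Ogg–Šafarevič record «good reduction ⇒ `T_ℓ A` unramified at `v`» consumed by
  the CM main-theorem cone (`H21_of_levelStructure`, binder `h₂`/`h₁₂`).

Everything is proved (no named facts).  Cell `hodgecm-mathlib`, programme «R-pkg» (torsion reduction-map package,
lead B-p20), slot T4 = field `smul_eq_self_of_mem_inertia` of `GoodReductionAt.TateSpecialisation` for the produced
good-reduction datum of an abelian-scheme model.

## References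
* [SerreTate1968] J.-P. Serre, J. Tate, *Good reduction of abelian varieties*, Ann. of Math. 88 (1968), §1, Thm. 1
  and Lemma 2.
* [NeukirchANT1999] J. Neukirch, *Algebraic Number Theory*, Ch. I §9 (conjugate primes, (9.1); inertia groups).
-/

noncomputable section

open CategoryTheory AlgebraicGeometry IsDedekindDomain IsDedekindDomain.HeightOneSpectrum
open Field
open scoped MonObj NumberField Pointwise
open Literature.AlgebraicGeometry.Motives Literature.AlgebraicGeometry.Motives.AbelianVariety
open Literature.NumberTheory.GaloisRepresentations

namespace Literature.NumberTheory.DiophantineGeometry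

variable {K : Type} [Field K] [NumberField K] {A : AbelianVariety K} {v : HeightOneSpectrum (𝓞 K)}
  {𝒜 : SchemeOver (valuationSubringAtPrime K v)} [GrpObj 𝒜]

/-! ### Inertia at `adicCompletionPrime K v` -/

/-- **Serre–Tate §1 (proof of Thm. 1), torsion level:** if the reduction map `red_v` of an abelian-scheme model of
`A` at `v` is injective on `A[m](K̄)`, then every `σ` in the inertia group of `𝔓ᵥ = adicCompletionPrime K v` fixes
`A[m](K̄)` pointwise.  Proof: `σ = res τ` with `τ ∈ I_{K_v}` (`inertia_adicCompletionPrime_eq_map_absInertia`),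
`red_v (res τ • x) = τ • red_v x = red_v x` (`specialFibreReductionHom_smul`,
`specialFibreGeomPoints_smul_eq_self_of_mem_absInertia`), and `σ • x ∈ A[m](K̄)`. [cite: SerreTate1968, §1 Thm. 1 and Lemma 2] -/
theorem IsAbelianSchemeModel.smul_eq_self_of_mem_inertia_of_mem_geomTorsion (h : IsAbelianSchemeModel A v 𝒜)
    {m : ℤ} (hinj : Set.InjOn h.specialFibreReductionHom (A.geomTorsion m : Set A.geomPoints))
    {σ : absoluteGaloisGroup K} (hσ : σ ∈ (adicCompletionPrime K v).inertia (absoluteGaloisGroup K))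
    {x : A.geomPoints} (hx : x ∈ A.geomTorsion m) : σ • x = x := by
  rw [inertia_adicCompletionPrime_eq_map_absInertia K v] at hσ
  obtain ⟨τ, hτ, rfl⟩ := Subgroup.mem_map.1 hσ
  refine hinj (smul_mem_geomTorsion _ hx) hx ?_
  letI := h.specialFibreGeomPointsAction
  change h.specialFibreReductionHom (absGaloisRestrict K (v.adicCompletion K) τ • x) = _
  rw [h.specialFibreReductionHom_smul, h.specialFibreGeomPoints_smul_eq_self_of_mem_absInertia hτ]

/-- **The `hinert` clause of `GoodReductionAt.exists_tateSpecialisation_of_reductionMap` at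
`𝔓 := adicCompletionPrime K v`:** granted injectivity of `red_v` on every `A[ℓⁿ](K̄)`, the inertia group of `𝔓ᵥ`
fixes all of them pointwise. [cite: SerreTate1968, §1 Thm. 1] -/
theorem IsAbelianSchemeModel.forall_smul_eq_self_of_mem_inertia_of_injOn (h : IsAbelianSchemeModel A v 𝒜) (ℓ : ℕ)
    (hinj : ∀ n : ℕ, Set.InjOn h.specialFibreReductionHom (A.geomTorsion (ℓ ^ n : ℕ) : Set A.geomPoints)) :
    ∀ (n : ℕ) (σ : absoluteGaloisGroup K), σ ∈ (adicCompletionPrime K v).inertia (absoluteGaloisGroup K) →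
      ∀ x : A.geomPoints, x ∈ A.geomTorsion (ℓ ^ n : ℕ) → σ • x = x :=
  fun n _ hσ _ hx => h.smul_eq_self_of_mem_inertia_of_mem_geomTorsion (hinj n) hσ hx

/-! ### Transport to every prime above `v` -/

omit [NumberField K] in
/-- If the inertia group of `𝔓` fixes pointwise a `Γ_K`-stable subset `S ⊆ A(K̄)`, then so does the inertia group
of the conjugate prime `τ • 𝔓` (`I(τ • 𝔓) = τ I(𝔓) τ⁻¹`, `Ideal.inertia_smul`). [cite: NeukirchANT1999, Ch. I §9] -/
theorem smul_eq_self_of_mem_inertia_smul_of_forall {𝔓 : Ideal (absIntegers (𝓞 K) K)} {S : Set A.geomPoints}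
    (hS : ∀ (g : absoluteGaloisGroup K), ∀ x ∈ S, g • x ∈ S)
    (h𝔓 : ∀ σ ∈ 𝔓.inertia (absoluteGaloisGroup K), ∀ x ∈ S, σ • x = x) (τ : absoluteGaloisGroup K)
    {σ : absoluteGaloisGroup K} (hσ : σ ∈ (τ • 𝔓).inertia (absoluteGaloisGroup K)) {x : A.geomPoints}
    (hx : x ∈ S) : σ • x = x := by
  rw [Ideal.inertia_smul, Subgroup.mem_pointwise_smul_iff_inv_smul_mem, MulAut.smul_def, MulAut.conj_inv_apply]
    at hσ
  have h1 := h𝔓 _ hσ (τ⁻¹ • x) (hS τ⁻¹ x hx)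
  rw [mul_smul, mul_smul, smul_inv_smul] at h1
  -- `h1 : τ⁻¹ • σ • x = τ⁻¹ • x`
  simpa using congrArg (fun y => τ • y) h1

/-- **Inertia at ANY prime `𝔓 ∣ v` of `ℤ̄_K` fixes `A[m](K̄)` pointwise** as soon as `red_v` is injective on
`A[m](K̄)`: the primes above `v` are conjugate under `Γ_K` (`exists_smul_eq_of_mem_primesAbove_holds`) and
`A[m](K̄)` is `Γ_K`-stable. [cite: SerreTate1968, §1 Thm. 1] [cite: NeukirchANT1999, Ch. I §9 Prop. (9.1)] -/
theorem IsAbelianSchemeModel.smul_eq_self_of_mem_inertia_of_mem_primesAbove (h : IsAbelianSchemeModel A v 𝒜)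
    {m : ℤ} (hinj : Set.InjOn h.specialFibreReductionHom (A.geomTorsion m : Set A.geomPoints))
    {𝔓 : Ideal (absIntegers (𝓞 K) K)} (h𝔓 : 𝔓 ∈ v.primesAbove)
    {σ : absoluteGaloisGroup K} (hσ : σ ∈ 𝔓.inertia (absoluteGaloisGroup K))
    {x : A.geomPoints} (hx : x ∈ A.geomTorsion m) : σ • x = x := by
  obtain ⟨τ, hτ⟩ := exists_smul_eq_of_mem_primesAbove_holds (K := K) (v := v)
    (adicCompletionPrime_mem_primesAbove K v) h𝔓
  subst hτ
  exact smul_eq_self_of_mem_inertia_smul_of_forall (S := (A.geomTorsion m : Set A.geomPoints))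
    (fun g _ hy => smul_mem_geomTorsion g hy)
    (fun _ hρ _ hy => h.smul_eq_self_of_mem_inertia_of_mem_geomTorsion hinj hρ hy) τ hσ hx

/-- The `hinert` clause of `GoodReductionAt.exists_tateSpecialisation_of_reductionMap` at an arbitrary prime
`𝔓 ∣ v`, granted injectivity of `red_v` on every `A[ℓⁿ](K̄)`. [cite: SerreTate1968, §1 Thm. 1] -/
theorem IsAbelianSchemeModel.forall_smul_eq_self_of_mem_inertia_of_mem_primesAbove (h : IsAbelianSchemeModel A v 𝒜)
    (ℓ : ℕ) (hinj : ∀ n : ℕ, Set.InjOn h.specialFibreReductionHom (A.geomTorsion (ℓ ^ n : ℕ) : Set A.geomPoints))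
    {𝔓 : Ideal (absIntegers (𝓞 K) K)} (h𝔓 : 𝔓 ∈ v.primesAbove) :
    ∀ (n : ℕ) (σ : absoluteGaloisGroup K), σ ∈ 𝔓.inertia (absoluteGaloisGroup K) →
      ∀ x : A.geomPoints, x ∈ A.geomTorsion (ℓ ^ n : ℕ) → σ • x = x :=
  fun n _ hσ _ hx => h.smul_eq_self_of_mem_inertia_of_mem_primesAbove (hinj n) h𝔓 hσ hx

/-! ### The `T_ℓ` form: `ρ_{A,ℓ}(I(𝔓)) = 1` -/

/-- **Serre–Tate Thm. 1, (b) ⇒ (c), at an abelian-scheme place:** if `red_v` is injective on every `A[ℓⁿ](K̄)`, then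
for every prime `𝔓 ∣ v` of `ℤ̄_K` the inertia group `I(𝔓)` acts trivially on `T_ℓ A`: `ρ_{A,ℓ}(σ) = 1`.
[cite: SerreTate1968, §1 Thm. 1] -/
theorem IsAbelianSchemeModel.forall_inertia_tateRep_eq_one_of_injOn (h : IsAbelianSchemeModel A v 𝒜) (ℓ : ℕ)
    [Fact ℓ.Prime]
    (hinj : ∀ n : ℕ, Set.InjOn h.specialFibreReductionHom (A.geomTorsion (ℓ ^ n : ℕ) : Set A.geomPoints))
    {𝔓 : Ideal (absIntegers (𝓞 K) K)} (h𝔓 : 𝔓 ∈ v.primesAbove) :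
    ∀ σ ∈ 𝔓.inertia (absoluteGaloisGroup K), A.tateRep ℓ σ = 1 :=
  fun _ hσ => tateRep_eq_one_of_forall_geomTorsion fun n _ hP =>
    h.smul_eq_self_of_mem_inertia_of_mem_primesAbove (hinj n) h𝔓 hσ hP

/-- **The Néron–Ogg–Šafarevič record in produced currency, modulo injectivity on torsion:** an abelian variety with
an abelian-scheme model at `v` whose reduction map is injective on every `A[ℓⁿ](K̄)` has a prime `𝔓 ∣ v` of `ℤ̄_K`
(namely `adicCompletionPrime K v`) whose inertia group acts trivially on `T_ℓ A` — the conclusion shape of the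
`h₂`/`h₁₂` record of the CM main-theorem cone. [cite: SerreTate1968, §1 Thm. 1] -/
theorem IsAbelianSchemeModel.exists_primesAbove_forall_inertia_tateRep_eq_one_of_injOn
    (h : IsAbelianSchemeModel A v 𝒜) (ℓ : ℕ) [Fact ℓ.Prime]
    (hinj : ∀ n : ℕ, Set.InjOn h.specialFibreReductionHom (A.geomTorsion (ℓ ^ n : ℕ) : Set A.geomPoints)) :
    ∃ 𝔓 ∈ v.primesAbove, ∀ σ ∈ 𝔓.inertia (absoluteGaloisGroup K), A.tateRep ℓ σ = 1 :=
  ⟨adicCompletionPrime K v, adicCompletionPrime_mem_primesAbove K v,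
    h.forall_inertia_tateRep_eq_one_of_injOn ℓ hinj (adicCompletionPrime_mem_primesAbove K v)⟩

/-- The same for EVERY prime above `v` (all inertia groups above `v` are conjugate). [cite: SerreTate1968, §1 Thm. 1] -/
theorem IsAbelianSchemeModel.forall_primesAbove_inertia_tateRep_eq_one_of_injOn
    (h : IsAbelianSchemeModel A v 𝒜) (ℓ : ℕ) [Fact ℓ.Prime]
    (hinj : ∀ n : ℕ, Set.InjOn h.specialFibreReductionHom (A.geomTorsion (ℓ ^ n : ℕ) : Set A.geomPoints)) :
    ∀ 𝔓 ∈ v.primesAbove, ∀ σ ∈ 𝔓.inertia (absoluteGaloisGroup K), A.tateRep ℓ σ = 1 :=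
  fun _ h𝔓 => h.forall_inertia_tateRep_eq_one_of_injOn ℓ hinj h𝔓

end Literature.NumberTheory.DiophantineGeometry

end
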